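import Literature.NumberTheory.Rogawski1990.LocalTransferTransportMeasure
import HarnessLib

/-!
# The transported orbital measure family READ AT A POINT — conjugator-free: `(conj q)_* ((ψ_* m′)[a]) = (cosetCongr ψ)_* (conj q′)_* (m′[ψ⁻¹ a])`
(Gelbart (1975), §10 pp. 154–155: orbital measures matched class by class along `G_S = G′_S`; Rogawski (1990), §4.3 p. 44: the local orbital
measures are normalised by «mass one» conditions on compact open subgroups for almost all `v`, §14.2 p. 232: «we fix an inner isomorphism ψ»)

Topic `NumberTheory/Rogawski1990`; namespace `Literature.NumberTheory.Rogawski1990` (sequel of ★ `LocalTransferTransportMeasure` (L6b)).  THEOREMS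
ONLY: no definition, no named fact, no instance, no `sorry`.  Cell `pub/hodgecm-mathlib`, ENGINE T1 (SPEC-ed1.19 §2 (mq), §3 (xii″) «measure data :=
transports of `𝔨.mq`», (viii′-3) normalisation «`atPoint γ_v (π K_v) = 1`»).

★ `OrbitalMeasureFamily.transport ψ` builds the class-`c` member of `ψ_* m′` from `m′(ψ⁻¹ c)` through a CHOSEN conjugator `x_c` (`transportConj`),
and a class-indexed family is read at a POINT `a` of a class through another chosen conjugator (`q · out[a] · q⁻¹ = a`; the cell's ★-to-be
`OrbitalMeasureFamily.atPoint` of Q4-C2 uses `conjOut a`).  For INVARIANT members all these choices are invisible: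

* §1 `cosetCongr_cosetCongr_centralizer` (composition of the induced maps of orbit quotients), **`map_cosetCongr_centralizer_eq_of_inner`** — two
  identifications `B ⧸ C(b₀) → A ⧸ C(a)` induced by isomorphisms `φ₁`, `φ₂ = conj(u) ∘ φ₁` with `u ∈ C(a)` push an invariant measure forward
  IDENTICALLY (`cosetCongr φ₂ = (u • ·) ∘ cosetCongr φ₁`); `preimage_cosetCongr_image_mk` (`cosetCongr e ⁻¹' π′(S′) = π(e⁻¹ S′)`).
* §2 **`map_conj_transport_mk_eq`**: for ANY conjugators `q` (of `out[a]` to `a` in `A`) and `q′` (of `out[ψ⁻¹a]` to `ψ⁻¹ a` in `B`) and `m′[ψ⁻¹ a]`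
  invariant, `(conj q)_* ((ψ_* m′)[a]) = (cosetCongr ψ)_* ((conj q′)_* (m′[ψ⁻¹ a]))` on `A ⧸ C(a)` — the two routes differ by `conj u`,
  `u = ψ(q′) x⁻¹ q⁻¹ ∈ C(a)`; and its set form **`map_conj_transport_mk_apply_image_mk`**: the `π(K)`-mass of the left side is the `π(ψ⁻¹K)`-mass of
  `(conj q′)_* (m′[ψ⁻¹ a])` for every `K ⊆ A` — so with a level-preserving `ψ_v` (`ψ_v⁻¹ K_v = K′_v`, ★ (Ψ⁺) `exists_psi_corresponds_forall_levelMatching`)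
  the a.e. normalisation of the inner form's family `mG` passes to the kit's quasi-split family `mq v := (ψ_v)_* mG v` point by point.
The dress over Q4-C2's `OrbitalMeasureFamily.atPoint` ∕ `UnitaryGroup.IsNormalisedOff` (take `q := conjOut a`, `q′ := conjOut (ψ⁻¹ a)`) is the sequel
edition once that file is in the tree.  HC_CM is proved only modulo the printed citations until rung 0 closes; this file is unconditional.

## References
* [Gelbart1975] S. Gelbart, *Automorphic forms on adele groups*, Ann. of Math. Stud. 83 (1975), §10 pp. 154–155, (9.13).
* [Rogawski1990] J. D. Rogawski, *Automorphic Representations of Unitary Groups in Three Variables*, Ann. of Math. Stud. 123 (1990), §4.3 p. 44,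
  §14.2 (14.2.1) p. 232.
-/

set_option autoImplicit false

noncomputable section

open MeasureTheory Topology
open scoped Pointwise

namespace Literature.NumberTheory.Rogawski1990

open Literature.MeasureTheory.Group Literature.NumberTheory.Automorphic

/-! ## §1 Identifications of orbit quotients that differ by an inner automorphism; pre-images of `π(S)` -/

section Inner

variable {A B : Type*} [Group A] [Group B]

/-- `cosetCongr φ′ ∘ cosetCongr φ = cosetCongr (φ.trans φ′)` on orbit quotients `C ⧸ C(c₀) → B ⧸ C(b₀) → A ⧸ C(a)` (pointwise; all three maps
are `x C(·) ↦ image C(·)`; plumbing for the orbit spaces `G ⧸ G_γ` of [Gelbart1975, (9.13)]). [cite: Gelbart1975, §10 pp. 154–155] -/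
theorem cosetCongr_cosetCongr_centralizer {C : Type*} [Group C] {c₀ : C} {b₀ : B} {a : A} (φ : C ≃* B) (φ' : B ≃* A)
    (hφ : ∀ g, φ g ∈ Subgroup.centralizer ({b₀} : Set B) ↔ g ∈ Subgroup.centralizer ({c₀} : Set C))
    (hφ' : ∀ g, φ' g ∈ Subgroup.centralizer ({a} : Set A) ↔ g ∈ Subgroup.centralizer ({b₀} : Set B))
    (hφφ' : ∀ g, (φ.trans φ') g ∈ Subgroup.centralizer ({a} : Set A) ↔ g ∈ Subgroup.centralizer ({c₀} : Set C))
    (x : C ⧸ Subgroup.centralizer ({c₀} : Set C)) :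
    cosetCongr φ' _ _ hφ' (cosetCongr φ _ _ hφ x) = cosetCongr (φ.trans φ') _ _ hφφ' x := by
  induction x using QuotientGroup.induction_on with
  | H g => rfl

variable [TopologicalSpace A] [TopologicalSpace B] [IsTopologicalGroup A]

variable {b₀ : B} {a : A}
  [MeasurableSpace (A ⧸ Subgroup.centralizer ({a} : Set A))] [BorelSpace (A ⧸ Subgroup.centralizer ({a} : Set A))]
  [MeasurableSpace (B ⧸ Subgroup.centralizer ({b₀} : Set B))] [BorelSpace (B ⧸ Subgroup.centralizer ({b₀} : Set B))]

/-- **Two identifications that differ by an inner automorphism centralising `a` push an INVARIANT orbital measure forward identically**: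
for `φ₁, φ₂ : B ≃* A` carrying `C(b₀)` onto `C(a)`, `φ₁` continuous, and `φ₂ = conj(u) ∘ φ₁` with `u ∈ C(a)`, every `B`-invariant measure
`μ` on `B ⧸ C(b₀)` has `(cosetCongr φ₁)_* μ = (cosetCongr φ₂)_* μ` (`cosetCongr φ₂ = (u • ·) ∘ cosetCongr φ₁` and the push-forward of `μ` along
`cosetCongr φ₁` is `A`-invariant, ★ `smulInvariantMeasure_map_cosetCongr_of_smulInvariantMeasure`) — the representative-independence of the
orbital measures matched «class by class» along `G_S = G′_S`. [cite: Gelbart1975, §10 pp. 154–155] -/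
theorem map_cosetCongr_centralizer_eq_of_inner (φ₁ φ₂ : B ≃* A)
    (h₁ : ∀ g, φ₁ g ∈ Subgroup.centralizer ({a} : Set A) ↔ g ∈ Subgroup.centralizer ({b₀} : Set B))
    (h₂ : ∀ g, φ₂ g ∈ Subgroup.centralizer ({a} : Set A) ↔ g ∈ Subgroup.centralizer ({b₀} : Set B))
    (hφ₁ : Continuous φ₁) (u : A) (hu : u ∈ Subgroup.centralizer ({a} : Set A)) (hφ₂ : ∀ b, φ₂ b = u * φ₁ b * u⁻¹)
    (μ : Measure (B ⧸ Subgroup.centralizer ({b₀} : Set B))) [SMulInvariantMeasure B (B ⧸ Subgroup.centralizer ({b₀} : Set B)) μ] :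
    μ.map (cosetCongr φ₁ _ _ h₁) = μ.map (cosetCongr φ₂ _ _ h₂) := by
  have hu' : u⁻¹ ∈ Subgroup.centralizer ({a} : Set A) := inv_mem hu
  have hcomp : cosetCongr φ₂ _ _ h₂ = (fun y : A ⧸ Subgroup.centralizer ({a} : Set A) => u • y) ∘ cosetCongr φ₁ _ _ h₁ := by
    funext x
    induction x using QuotientGroup.induction_on with
    | H b =>
      simp only [Function.comp_apply, cosetCongr_mk, MulAction.Quotient.smul_mk, smul_eq_mul, hφ₂]
      exact QuotientGroup.mk_mul_of_mem _ hu'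
  rw [hcomp, ← Measure.map_map (measurable_const_smul u) (measurable_cosetCongr φ₁ _ _ h₁ hφ₁)]
  haveI := smulInvariantMeasure_map_cosetCongr_of_smulInvariantMeasure φ₁ _ _ h₁ hφ₁ μ
  exact (MeasureTheory.map_smul u _).symm

end Inner


section Preimage

variable {G G' : Type*} [Group G] [Group G'] (e : G ≃* G') (K : Subgroup G) (K' : Subgroup G') (hKK' : ∀ g, e g ∈ K' ↔ g ∈ K)

/-- **`cosetCongr e ⁻¹' (π′ S′) = π (e⁻¹ S′)`**: the pre-image under the induced map of coset spaces of the image of a set `S′ ⊆ G′` in `G′ ⧸ K′` is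
the image in `G ⧸ K` of `e⁻¹ S′` (plumbing for the `K`-orbit masses of [Rogawski1990, §4.3 p. 44]). [cite: Rogawski1990, §4.3 p. 44] -/
theorem preimage_cosetCongr_image_mk (S' : Set G') :
    cosetCongr e K K' hKK' ⁻¹' ((QuotientGroup.mk : G' → G' ⧸ K') '' S') = (QuotientGroup.mk : G → G ⧸ K) '' (e.symm '' S') := by
  ext x
  induction x using QuotientGroup.induction_on with
  | H g =>
    simp only [Set.mem_preimage, cosetCongr_mk, Set.mem_image, exists_exists_and_eq_and]
    constructor
    · rintro ⟨s, hs, h⟩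
      refine ⟨s, hs, ?_⟩
      rw [QuotientGroup.eq] at h ⊢
      rw [← hKK', map_mul, map_inv, MulEquiv.apply_symm_apply]
      exact h
    · rintro ⟨s, hs, h⟩
      refine ⟨s, hs, ?_⟩
      rw [QuotientGroup.eq] at h ⊢
      rw [← hKK', map_mul, map_inv, MulEquiv.apply_symm_apply] at h
      exact h

end Preimage

/-! ## §2 `ψ_* m′` read at a point `a`, for any conjugators -/

section TransportPoint

variable {A B : Type*} [Group A] [Group B] (ψ : B ≃* A) [TopologicalSpace A] [TopologicalSpace B] [IsTopologicalGroup A]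
  [IsTopologicalGroup B] (hψ : Continuous ψ) (hψs : Continuous ψ.symm)
  [∀ a : A, MeasurableSpace (A ⧸ Subgroup.centralizer ({a} : Set A))] [∀ a : A, BorelSpace (A ⧸ Subgroup.centralizer ({a} : Set A))]
  [∀ b : B, MeasurableSpace (B ⧸ Subgroup.centralizer ({b} : Set B))] [∀ b : B, BorelSpace (B ⧸ Subgroup.centralizer ({b} : Set B))]
  (m' : OrbitalMeasureFamily B)

/-- **The transported family read AT A POINT is the family read at the pre-image point, pushed along `ψ` itself — for ANY conjugators**:
for `a ∈ A`, `q ∈ A` with `q · out[a] · q⁻¹ = a`, `q′ ∈ B` with `q′ · out[ψ⁻¹ a] · q′⁻¹ = ψ⁻¹ a`, and `m′[ψ⁻¹ a]` invariant,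
`(conj q)_* ((ψ_* m′)[a]) = (cosetCongr ψ)_* ((conj q′)_* (m′[ψ⁻¹ a]))` on `A ⧸ C(a)` — the two identifications
`B ⧸ C(out[ψ⁻¹a]) ≃ A ⧸ C(a)` differ by the inner automorphism of `u = ψ(q′) x⁻¹ q⁻¹ ∈ C(a)` (`x` the conjugator chosen inside
★ `OrbitalMeasureFamily.transport`), invisible on invariant measures. [cite: Gelbart1975, §10 pp. 154–155] -/
theorem map_conj_transport_mk_eq (a q : A) (hq : MulAut.conj q (Quotient.out (ConjClasses.mk a) : A) = a) (q' : B)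
    (hq' : MulAut.conj q' (Quotient.out (ConjClasses.mk (ψ.symm a)) : B) = ψ.symm a)
    [SMulInvariantMeasure B (B ⧸ Subgroup.centralizer ({(Quotient.out (ConjClasses.mk (ψ.symm a)) : B)} : Set B))
      (m' (ConjClasses.mk (ψ.symm a)))] :
    ((m'.transport ψ hψ hψs) (ConjClasses.mk a)).map
        (cosetCongr (MulAut.conj q) _ (Subgroup.centralizer ({a} : Set A))
          (forall_apply_mem_centralizer_singleton_iff_of_eq (MulAut.conj q) hq)) =
      ((m' (ConjClasses.mk (ψ.symm a))).map
        (cosetCongr (MulAut.conj q') _ (Subgroup.centralizer ({ψ.symm a} : Set B))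
          (forall_apply_mem_centralizer_singleton_iff_of_eq (MulAut.conj q') hq'))).map
        (cosetCongr ψ (Subgroup.centralizer ({ψ.symm a} : Set B)) (Subgroup.centralizer ({a} : Set A))
          (forall_apply_mem_centralizer_singleton_iff_of_eq ψ (ψ.apply_symm_apply a))) := by
  -- the class of `B` under `[a]` IS `[ψ⁻¹ a]`, definitionally
  have hpre : preClass ψ (ConjClasses.mk a) = ConjClasses.mk (ψ.symm a) := rfl
  haveI : SMulInvariantMeasure B (B ⧸ Subgroup.centralizer ({(Quotient.out (preClass ψ (ConjClasses.mk a)) : B)} : Set B))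
      (m' (preClass ψ (ConjClasses.mk a))) := ‹_›
  -- drop the left translation inside `transport` (invariance), and compose the `cosetCongr`s on both sides
  rw [transport_apply]
  haveI := smulInvariantMeasure_map_cosetCongr_of_smulInvariantMeasure (transportEquiv ψ (ConjClasses.mk a)) _ _
    (forall_apply_mem_centralizer_singleton_iff_of_eq (transportEquiv ψ (ConjClasses.mk a)) (transportEquiv_out ψ (ConjClasses.mk a)))
    (continuous_transportEquiv ψ hψ (ConjClasses.mk a)) (m' (preClass ψ (ConjClasses.mk a)))
  rw [MeasureTheory.map_smul,
    Measure.map_map (measurable_cosetCongr (MulAut.conj q) _ _ _ (IsTopologicalGroup.continuous_conj q))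
      (measurable_cosetCongr (transportEquiv ψ (ConjClasses.mk a)) _ _ _ (continuous_transportEquiv ψ hψ (ConjClasses.mk a))),
    Measure.map_map (measurable_cosetCongr ψ _ _ _ hψ)
      (measurable_cosetCongr (MulAut.conj q') _ _ _ (IsTopologicalGroup.continuous_conj q'))]
  have htr : ((transportEquiv ψ (ConjClasses.mk a)).trans (MulAut.conj q)) (Quotient.out (ConjClasses.mk (ψ.symm a)) : B) = a := by
    rw [MulEquiv.trans_apply, ← hpre, transportEquiv_out, hq]
  have htr' : ((MulAut.conj q').trans ψ) (Quotient.out (ConjClasses.mk (ψ.symm a)) : B) = a := by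
    rw [MulEquiv.trans_apply, hq', MulEquiv.apply_symm_apply]
  -- both composites as ONE `cosetCongr` on `B ⧸ C(out [ψ⁻¹ a])` (the class `ψ⁻¹ [a]` is `[ψ⁻¹ a]` definitionally)
  have hL : (cosetCongr (MulAut.conj q) (Subgroup.centralizer ({(Quotient.out (ConjClasses.mk a) : A)} : Set A))
        (Subgroup.centralizer ({a} : Set A)) (forall_apply_mem_centralizer_singleton_iff_of_eq (MulAut.conj q) hq)) ∘
      (cosetCongr (transportEquiv ψ (ConjClasses.mk a))
        (Subgroup.centralizer ({(Quotient.out (ConjClasses.mk (ψ.symm a)) : B)} : Set B))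
        (Subgroup.centralizer ({(Quotient.out (ConjClasses.mk a) : A)} : Set A))
        (forall_apply_mem_centralizer_singleton_iff_of_eq (transportEquiv ψ (ConjClasses.mk a))
          (transportEquiv_out ψ (ConjClasses.mk a)))) =
      cosetCongr ((transportEquiv ψ (ConjClasses.mk a)).trans (MulAut.conj q))
        (Subgroup.centralizer ({(Quotient.out (ConjClasses.mk (ψ.symm a)) : B)} : Set B)) (Subgroup.centralizer ({a} : Set A))
        (forall_apply_mem_centralizer_singleton_iff_of_eq _ htr) :=
    funext fun x => cosetCongr_cosetCongr_centralizer _ _ _ _ _ x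
  have hR : (cosetCongr ψ (Subgroup.centralizer ({ψ.symm a} : Set B)) (Subgroup.centralizer ({a} : Set A))
        (forall_apply_mem_centralizer_singleton_iff_of_eq ψ (ψ.apply_symm_apply a))) ∘
      (cosetCongr (MulAut.conj q') (Subgroup.centralizer ({(Quotient.out (ConjClasses.mk (ψ.symm a)) : B)} : Set B))
        (Subgroup.centralizer ({ψ.symm a} : Set B)) (forall_apply_mem_centralizer_singleton_iff_of_eq (MulAut.conj q') hq')) =
      cosetCongr ((MulAut.conj q').trans ψ)
        (Subgroup.centralizer ({(Quotient.out (ConjClasses.mk (ψ.symm a)) : B)} : Set B)) (Subgroup.centralizer ({a} : Set A))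
        (forall_apply_mem_centralizer_singleton_iff_of_eq _ htr') :=
    funext fun x => cosetCongr_cosetCongr_centralizer _ _ _ _ _ x
  change (m' (ConjClasses.mk (ψ.symm a))).map
      ((cosetCongr (MulAut.conj q) (Subgroup.centralizer ({(Quotient.out (ConjClasses.mk a) : A)} : Set A))
        (Subgroup.centralizer ({a} : Set A)) (forall_apply_mem_centralizer_singleton_iff_of_eq (MulAut.conj q) hq)) ∘
      (cosetCongr (transportEquiv ψ (ConjClasses.mk a))
        (Subgroup.centralizer ({(Quotient.out (ConjClasses.mk (ψ.symm a)) : B)} : Set B))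
        (Subgroup.centralizer ({(Quotient.out (ConjClasses.mk a) : A)} : Set A))
        (forall_apply_mem_centralizer_singleton_iff_of_eq (transportEquiv ψ (ConjClasses.mk a))
          (transportEquiv_out ψ (ConjClasses.mk a))))) =
    (m' (ConjClasses.mk (ψ.symm a))).map
      ((cosetCongr ψ (Subgroup.centralizer ({ψ.symm a} : Set B)) (Subgroup.centralizer ({a} : Set A))
        (forall_apply_mem_centralizer_singleton_iff_of_eq ψ (ψ.apply_symm_apply a))) ∘
      (cosetCongr (MulAut.conj q') (Subgroup.centralizer ({(Quotient.out (ConjClasses.mk (ψ.symm a)) : B)} : Set B))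
        (Subgroup.centralizer ({ψ.symm a} : Set B)) (forall_apply_mem_centralizer_singleton_iff_of_eq (MulAut.conj q') hq')))
  rw [hL, hR]
  -- the two identifications differ by `conj u`, `u = ψ q′ · x⁻¹ · q⁻¹ ∈ C(a)`
  refine map_cosetCongr_centralizer_eq_of_inner _ _ _ _
    ((IsTopologicalGroup.continuous_conj q).comp (continuous_transportEquiv ψ hψ (ConjClasses.mk a)))
    (ψ q' * ((transportConj ψ (ConjClasses.mk a))⁻¹ * q⁻¹)) ?_ (fun b => ?_) _
  · -- `u ∈ C(a)`: both `q x` and `ψ q′` conjugate `ψ(out[ψ⁻¹ a])` to `a`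
    rw [Subgroup.mem_centralizer_singleton_iff]
    have h1 : a = q * (transportConj ψ (ConjClasses.mk a) * ψ (Quotient.out (ConjClasses.mk (ψ.symm a)) : B) *
        (transportConj ψ (ConjClasses.mk a))⁻¹) * q⁻¹ := by
      rw [show transportConj ψ (ConjClasses.mk a) * ψ (Quotient.out (ConjClasses.mk (ψ.symm a)) : B) *
          (transportConj ψ (ConjClasses.mk a))⁻¹ = (Quotient.out (ConjClasses.mk a) : A) from transportConj_spec ψ (ConjClasses.mk a)]
      exact hq.symm
    have h2 : a = ψ q' * ψ (Quotient.out (ConjClasses.mk (ψ.symm a)) : B) * (ψ q')⁻¹ := by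
      rw [← map_inv, ← map_mul, ← map_mul, ← MulAut.conj_apply, hq', MulEquiv.apply_symm_apply]
    calc ψ q' * ((transportConj ψ (ConjClasses.mk a))⁻¹ * q⁻¹) * a
        = ψ q' * ((transportConj ψ (ConjClasses.mk a))⁻¹ * q⁻¹) *
            (q * (transportConj ψ (ConjClasses.mk a) * ψ (Quotient.out (ConjClasses.mk (ψ.symm a)) : B) *
              (transportConj ψ (ConjClasses.mk a))⁻¹) * q⁻¹) := by rw [← h1]
      _ = ψ q' * ψ (Quotient.out (ConjClasses.mk (ψ.symm a)) : B) * (ψ q')⁻¹ *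
            (ψ q' * ((transportConj ψ (ConjClasses.mk a))⁻¹ * q⁻¹)) := by group
      _ = a * (ψ q' * ((transportConj ψ (ConjClasses.mk a))⁻¹ * q⁻¹)) := by rw [← h2]
  · simp only [MulEquiv.trans_apply, MulAut.conj_apply, transportEquiv_apply, map_mul, map_inv]
    group


/-- **The `K`-orbit mass of the transported family read at a point**: with conjugators `q`, `q′` as in `map_conj_transport_mk_eq` and `m′[ψ⁻¹ a]`
invariant, for every `K ⊆ A` the measure of `π(K) ⊆ A ⧸ C(a)` under `(conj q)_* ((ψ_* m′)[a])` is the measure of `π(ψ⁻¹ K) ⊆ B ⧸ C(ψ⁻¹ a)` under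
`(conj q′)_* (m′[ψ⁻¹ a])` — the shape in which «mass one on the image of a compact open subgroup» (the a.e. normalisation of local orbital
measures, [Rogawski1990, §4.3 p. 44]) passes from `m′` to `ψ_* m′` when `ψ⁻¹ K = K′`. [cite: Rogawski1990, §4.3 p. 44] [cite: Gelbart1975, §10 pp. 154–155] -/
theorem map_conj_transport_mk_apply_image_mk (a q : A) (hq : MulAut.conj q (Quotient.out (ConjClasses.mk a) : A) = a) (q' : B)
    (hq' : MulAut.conj q' (Quotient.out (ConjClasses.mk (ψ.symm a)) : B) = ψ.symm a)
    [SMulInvariantMeasure B (B ⧸ Subgroup.centralizer ({(Quotient.out (ConjClasses.mk (ψ.symm a)) : B)} : Set B))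
      (m' (ConjClasses.mk (ψ.symm a)))] (K : Set A) :
    ((m'.transport ψ hψ hψs) (ConjClasses.mk a)).map
        (cosetCongr (MulAut.conj q) _ (Subgroup.centralizer ({a} : Set A))
          (forall_apply_mem_centralizer_singleton_iff_of_eq (MulAut.conj q) hq))
        ((QuotientGroup.mk : A → A ⧸ Subgroup.centralizer ({a} : Set A)) '' K) =
      ((m' (ConjClasses.mk (ψ.symm a))).map
        (cosetCongr (MulAut.conj q') _ (Subgroup.centralizer ({ψ.symm a} : Set B))
          (forall_apply_mem_centralizer_singleton_iff_of_eq (MulAut.conj q') hq')))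
        ((QuotientGroup.mk : B → B ⧸ Subgroup.centralizer ({ψ.symm a} : Set B)) '' (ψ.symm '' K)) := by
  rw [map_conj_transport_mk_eq ψ hψ hψs m' a q hq q' hq',
    ← coe_cosetCongrMeasurableEquiv ψ _ _ (forall_apply_mem_centralizer_singleton_iff_of_eq ψ (ψ.apply_symm_apply a)) hψ hψs,
    MeasurableEquiv.map_apply, coe_cosetCongrMeasurableEquiv, preimage_cosetCongr_image_mk]

end TransportPoint

end Literature.NumberTheory.Rogawski1990

end
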